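import Literature.MathematicalPhysics.QuantumFieldTheory.Balaban1983to89.B16Ineq197Window
import Literature.MathematicalPhysics.QuantumFieldTheory.Balaban1983to89.B16MergeHorizon
import Literature.MathematicalPhysics.QuantumFieldTheory.Balaban1983to89.B13Factor210Literal

/-!
# `Balaban1983to89.B16Ineq197ClassOne` (v1) — the two VOLUME CLAUSES of the class-1 components in the lattice model of
[Balaban1989LargeFieldII] (1.91) ⇒ (1.97) (`…B16Ineq197Window.Model.card_le` ∕ `.le_card`: `#X_j ≤ V`, `n ≤ #X_j`),
DISCHARGED in the ℤᵈ index model at the printed grades `V = (100R_k)^d`, `n = R_k^d` from the two printed geometric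
inputs — «X_j is a union of MR_k-cubes» and condition (i) «contained in a cube of the size 100MR_k» — read BY NAME through
the cell's existing typed objects (`…B13Factor210Literal.fineCubes`, `…B16StoppingRule.CondI`, `…B14BoxFix.FitsIn`,
`…B13ScaleTransfer.{coarse, closureIdx, FaceConnected}`); with the dictionary facts a joiner needs to place the class-1
components on the MR_k-lattice: cube counts (`#fineCubes R S = R^d·#S`), covers (`closureIdx R (fineCubes R S) = S`),
condition (i) across the two lattices (`FitsIn Nsz S → FitsIn (Nsz·R) (fineCubes R S)`), and FACE-CONNECTEDNESS of the
M-cube family of a face-connected MR_k-cube family (`faceConnected_fineCubes`; boxes are face-connected, `faceConnected_pbox`).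
Unit b2b-balaban-b02 (PAPER SUB-CELL B02 = B16 owner lineage), gen 19 — NEW leaf module; imports `…B16Ineq197Window`,
`…B16MergeHorizon`, `…B13Factor210Literal`; modifies nothing.

CITATION HEADER (lean-in-tree rule 2026-08-18).  Source under audit (cell paper B16): T. Bałaban, *Large field
renormalization. II. Localization, exponentiation, and bounds for the 𝐑 operation*, Commun. Math. Phys. **122**, 355–392
(1989), doi:10.1007/bf01238433 [Balaban1989LargeFieldII] (held `paper:balaban1989-cmp122-large-field-ii`; journal page =
PDF page + 354; renders `…1989-cmp122-large-field-II-pNNN-x2.png` read as images by the typing unit).  Printed, verbatim: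
p. 384 [PDF 30]: *"If Z is a union of MR_j-cubes of the lattice T_ξ, ξ = L^{−j}, then we take the cover Z′ of Z by a
smallest union of LMR_{j+1}-cubes, and we add ten layers of such cubes."* and *"The domain Z is a union of MR_j-cubes □,
Z = ⋃_{□⊂Z} □"*, with cube counts written as volumes, *"d′_n(S^{n−j}(Z)) ≦ (63)^d(MR_n)^{−d}|Z^{(n−j)}|"*; p. 378 [PDF 24]:
*"Thus, the components of Z are divided into two classes. For components of the first class, denoted by {X_1,…,X_n},
there are only the characteristic functions χ_k(X_i^{~−6})"*; p. 387 [PDF 33]: *"The domain S^{K_1}(X) satisfies the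
conditions (i), (ii), in particular it is contained in a cube of the size 100MR_{j+1+K_1}"* and *"At first, the domain X
in the definition (1.71) satisfies the assumption of the statement with K = 0, therefore κ_k(X) ≧ 0"*; p. 388 [PDF 34],
the third factor of (1.93): *"∏_{h=1}^q exp((1 + β + (1/(3·2^d))β)κM^{−d}|X_{j_h}|)"*; p. 389 [PDF 35]: *"The product
over h there is estimated by ∏_{h=1}^q exp 2κ(100R_k)^d, and this product is combined with the first product on the
right-hand side of (1.92)."* and (1.96): *"≦ exp(exp(−½p₀(g_k))100^d(MR_k)^{−d}|X′∖∪Y_i|)"*.  Condition (i) itself is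
[Balaban1989LargeFieldI] p. 177, *"(i) it is contained in a cube of the size 100 MR_k"*, typed in the cell as
`…B16StoppingRule.CondI` (= `…B14BoxFix.FitsIn` on cube indices).  The Bałaban papers are manuscripts UNDER ADJUDICATION
by the audit cell `pub-balaban`: NOTHING printed in them is asserted here.  What enters is the cell's certified READING of
the two volume clauses (SMALLNESS.md S-B16.12 ∕ S-B16.13, GAPS.md C-adv6-51 (3), C-adv7-64, as already recorded in the
headers of `…B16Ineq197XBudget` and `…B16Count196Packing`): «M^{−d}|X_{j_h}| ≤ (100R_k)^d BECAUSE the class-1 component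
X_{j_h} satisfies (i) at scale k» and «each X_{j_h} contains an MR_k-cube, hence ≥ R_k^d M-cubes, BECAUSE it is a
non-empty union of MR_k-cubes» — and this module proves, over NAMED HYPOTHESES of exactly that shape, the finite
combinatorics turning them into the two `Model` fields.  No new quotation of a disputed step is introduced and no printed
estimate is used as a hypothesis-free fact.

THE DICTIONARY.  The carrier of `…B16Ineq197Window.Model` is the M-cube index lattice ℤᵈ = `Pt d` of b01's windows
(`comp j` = the M-cubes of X_j, `#(comp j)` = M^{−d}|X_j|).  The MR_k-cubes are the cubes of the R-times coarser NESTED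
partition, R = R_k ∈ ℕ (a power of L in the programme, [Balaban1988Convergent] (2.5); here any R ≥ 1): the MR_k-cube of
index b ∈ ℤᵈ is the family of the R^d M-cubes x with R·b_i ≤ x_i < R·b_i + R — BY NAME `…B13Factor210Literal.fineCubes R {b}`
(model convention (m2) of that module; `…B13ScaleTransfer.coarse R x = b`, `coarse_eq_iff`; `coarse = …B14DomainGeom.cubeIdx`
definitionally, `coarse_eq_cubeIdx`).  «X_j is a union of MR_k-cubes with index set S_j» ↔ `comp j = fineCubes R (S j)`,
equivalently `fineCubes R (closureIdx R (comp j)) = comp j` (`closureIdx R` = the cover by MR_k-cubes, p. 384's Z^{(·)},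
[Balaban1988RG2Cluster] p. 13 as typed in `…B13ScaleTransfer`).  Condition (i) for X_j AT SCALE k ↔ `CondI Nsz (S j)`,
Nsz = 100, on MR_k-cube indices (the reading of `…B16StoppingRule` ∕ `…B16MergeHorizon`, where domains of the scale-k
lattice are finite sets of MR_k-cube indices); on M-cube indices it becomes `FitsIn (Nsz·R) (comp j)`
(`fitsIn_fineCubes`).  Then M^{−d}|X_j| = #(comp j) = R^d·#(S j) (`card_fineCubes`) ≤ (Nsz·R)^d = V
(`card_fineCubes_le_of_condI`; print (100R_k)^d) and, X_j ≠ ∅, #(comp j) ≥ R^d = n (`pow_le_card_fineCubes`; one MR_k-cube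
is R_k^d M-cubes, the sharp density of `…B16Count196Packing`).  The face-connectedness of `comp j` required by
`Model.comp_spec` (a class-1 component is a component, hence connected, of the large-field region) follows from that of
S j (`faceConnected_fineCubes`) and conversely (`…B13ScaleTransfer.faceConnected_closureIdx`), `faceConnected_fineCubes_iff`.

WHAT IS PROVED (no `sorry`, no new axioms; [folklore] = elementary finite combinatorics of ℤᵈ): §1 `card_pbox_eq_pow`,
`card_le_pow_of_fitsIn` (a finite set satisfying (i) with size N has ≤ N^d cubes), `card_le_pow_of_condI`,
`mem_pbox_update`, `pref_mem_pbox`, `linked_pbox_update_add`, `linked_pbox_update`, `faceConnected_pbox` (every box of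
ℤᵈ is face-connected); §2 `coarse_eq_cubeIdx`, `corner`, `coarse_corner`, `mem_fineCubes_coarse`, `mem_fineCubes_singleton`,
`fineCubes_singleton_eq_pbox`, `corner_mem_fineCubes_singleton`, `mem_fineCubes_singleton_coarse`, `card_fineCubes_singleton`
(= R^d), `fineCubes_eq_biUnion`, `pairwiseDisjoint_fineCubes_singleton`, `card_fineCubes` (= R^d·#S), `closureIdx_fineCubes`
(= S), `subset_fineCubes_closureIdx`, `fineCubes_mono`, `fineCubes_nonempty_iff`, `fineCubes_one`, `card_eq_of_cubeUnion`;
§3 `pow_le_card_fineCubes`, `card_fineCubes_le_of_condI`, `fitsIn_of_fitsIn_closureIdx`, `fitsIn_fineCubes`; §4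
`faceConnected_fineCubes_singleton`, `corner_update_eq`, `linked_corner_update`, `linked_corner_of_adj`,
`linked_fineCubes_corner`, `faceConnected_fineCubes`, `faceConnected_fineCubes_iff`; §5 the hypothesis structure `ClassOne R Nsz cand comp`
(R ≥ 1; every `comp j` is the M-cube family of its MR_k-cover; the cover satisfies (i) with size Nsz) with `ClassOne.card_eq`,
`ClassOne.card_le` (`#(comp j) ≤ (Nsz·R)^d`, real form), `ClassOne.le_card` (`R^d ≤ #(comp j)` for non-empty components),
`ClassOne.of_fineCubes` (the structure from `comp j = fineCubes R (S j)` and `CondI Nsz (S j)`), `regrade`, `regrade_comp`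
(a `Model` at grades (V, n) is a `Model` at any grades its components meet, same components), `card_le_card_of_subset_sdiff`
(the trivial grade V = #X′), `classOne`, `classOne_comp` (a `Model` at ANY grades plus `ClassOne R Nsz` ⇒ the `Model` at
V = (Nsz·R)^d, n = R^d, same components), `leaves_classOne`, `ineq197_classOne` (`…B16Ineq197Window.ineq197_window` with
the two volume clauses discharged), `clauses_printed_four` (at d = 4, Nsz = 100 the clauses of `…Window.clauses_four_printed`
are the clauses at these grades); §6 non-vacuity `Toy.B₂_subset_pbox`, `Toy.condI_two`, `Toy.classOne_toy` (the toy model of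
`…B16Ineq197Window` is class-one with R = 1, Nsz = 2), `Toy.toyM_classOne_grades` (`classOne` returns it at its own grades
V = 2, n = 1 with the same components), `Toy.toy_leaves_classOne` (the five leaves of the toy polymer through `leaves_classOne`).
WHAT IS *NOT* PROVED: that the class-1 components of the actual 𝐑-operation polymers ARE unions of MR_k-cubes satisfying
(i) — this is the lattice geometry of [Balaban1989LargeFieldI] pp. 175–177 ∕ [Balaban1989LargeFieldII] pp. 378, 384–387
(large-field regions are built from MR_k-cubes; class-1 components satisfy (i), (ii)), which stays the two named fields of
`ClassOne` for the joiner, exactly as the other incidences stay fields of `Model`; nor any other field of `Model`; nor the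
numeric clauses of `Consts.Small` (SMALLNESS business).  Value: the joiner's obligations `card_le`, `le_card` at the
printed grades are reduced to two print-level set facts on the MR_k-lattice, and the M ↔ MR_k dictionary (counts, covers,
(i), connectedness) is kernel-available; bookkeeping, LOW difficulty; NOT summit progress; NOT continuum; NOT Clay.
Cell records: GAPS.md C-b02g19-1; HOME/HANDOFF.md (b02 lineage, gen 19).  Naming: `B16Ineq197.Polymer`, `B16Ineq197.Consts`
and the `…Window` objects are written QUALIFIED or opened by name (cf. `B16Ineq197` header note N1).
-/

namespace Literature.MathematicalPhysics.QuantumFieldTheory.Balaban1983to89.B16Ineq197ClassOne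

open Literature.MathematicalPhysics.QuantumFieldTheory.Balaban1983to89
open Literature.MathematicalPhysics.QuantumFieldTheory.Balaban1983to89.B13ScaleTransfer
open Literature.MathematicalPhysics.QuantumFieldTheory.Balaban1983to89.TreeLength
open Literature.MathematicalPhysics.QuantumFieldTheory.Balaban1983to89.B14.RelTreeLength
open Literature.MathematicalPhysics.QuantumFieldTheory.Balaban1983to89.B16Absorption (pbox mem_pbox card_pbox)
open Literature.MathematicalPhysics.QuantumFieldTheory.Balaban1983to89.B16StoppingRule (CondI)
open Literature.MathematicalPhysics.QuantumFieldTheory.Balaban1983to89.B13Factor210Literal (fineCubes mem_fineCubes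
  disjoint_fineCubes)
open Literature.MathematicalPhysics.QuantumFieldTheory.Balaban1983to89.B14DomainGeom (cubeIdx cubeIdx_corner)
open Literature.MathematicalPhysics.QuantumFieldTheory.Balaban1983to89.B16Ineq197Window (Model Clauses)

noncomputable section

variable {d : ℕ}

/-! ## §1. Boxes of ℤᵈ: cube counts under condition (i), and face-connectedness -/

/-- A product box with `N` indices per side has `N^d` cubes. [folklore] -/
theorem card_pbox_eq_pow {lo hi : Pt d} {N : ℕ} (h : ∀ i, hi i = lo i + (N : ℤ) - 1) : (pbox lo hi).card = N ^ d := by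
  rw [card_pbox]
  have h1 : ∀ i, (hi i + 1 - lo i).toNat = N := fun i => by
    rw [h i]
    have e : lo i + (N : ℤ) - 1 + 1 - lo i = (N : ℤ) := by ring
    rw [e, Int.toNat_natCast]
  simp only [h1, Finset.prod_const, Finset.card_univ, Fintype.card_fin]

/-- **A FINITE SET OF CUBE INDICES SATISFYING (i) WITH SIZE `N` HAS AT MOST `N^d` CUBES** (`…B14BoxFix.FitsIn`: inside a box of
`N` indices per side). [folklore] -/
theorem card_le_pow_of_fitsIn {N : ℕ} {S : Finset (Pt d)} (h : B14BoxFix.FitsIn N (↑S : Set (Pt d))) :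
    S.card ≤ N ^ d := by
  obtain ⟨lo, hi, hsub, hhi⟩ := B16MergeHorizon.exists_pbox_of_fitsIn h
  exact (Finset.card_le_card hsub).trans (card_pbox_eq_pow hhi).le

/-- The same for the typed condition (i) `CondI Nsz X` of `…B16StoppingRule`. [cite: Balaban1989LargeFieldI, p.177 (condition (i))] -/
theorem card_le_pow_of_condI {Nsz : ℕ} {X : Finset (Pt d)} (h : CondI Nsz X) : X.card ≤ Nsz ^ d :=
  card_le_pow_of_fitsIn h

/-- Changing one coordinate within the bounds keeps a cube in the box. [folklore] -/
theorem mem_pbox_update {lo hi x : Pt d} (hx : x ∈ pbox lo hi) (i : Fin d) {t : ℤ} (h1 : lo i ≤ t) (h2 : t ≤ hi i) :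
    Function.update x i t ∈ pbox lo hi := by
  rw [mem_pbox] at hx ⊢
  intro j
  by_cases hji : j = i
  · subst hji
    rw [Function.update_self]
    exact ⟨h1, h2⟩
  · rw [Function.update_of_ne hji]
    exact hx j

/-- The coordinate-by-coordinate chain `pref x y j` from `x` to `y` (`…B13ScaleTransfer.pref`) stays in a box containing
both. [folklore] -/
theorem pref_mem_pbox {lo hi x y : Pt d} (hx : x ∈ pbox lo hi) (hy : y ∈ pbox lo hi) (j : ℕ) :
    pref x y j ∈ pbox lo hi := by
  rw [mem_pbox] at hx hy ⊢
  intro i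
  by_cases h : (i : ℕ) < j
  · simp only [pref, h, if_true]
    exact hy i
  · simp only [pref, h, if_false]
    exact hx i

/-- Moving one coordinate UP by `n` unit steps inside the box is a common-wall chain inside the box. [folklore] -/
theorem linked_pbox_update_add {lo hi x : Pt d} (hx : x ∈ pbox lo hi) (i : Fin d) :
    ∀ n : ℕ, x i + (n : ℤ) ≤ hi i → Linked (pbox lo hi) x (Function.update x i (x i + n))
  | 0, _ => by
    rw [Nat.cast_zero, add_zero, Function.update_eq_self]
    exact Relation.ReflTransGen.refl
  | n + 1, hn => by
    have hlo : lo i ≤ x i := ((mem_pbox.1 hx) i).1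
    have hn' : x i + (n : ℤ) ≤ hi i := by push_cast at hn; linarith
    have ih := linked_pbox_update_add hx i n hn'
    have hu : Function.update x i (x i + n) ∈ pbox lo hi := mem_pbox_update hx i (by linarith) hn'
    have hv : Function.update x i (x i + ((n + 1 : ℕ) : ℤ)) ∈ pbox lo hi :=
      mem_pbox_update hx i (by push_cast; linarith) hn
    have hadj : Adj (Function.update x i (x i + n)) (Function.update x i (x i + ((n + 1 : ℕ) : ℤ))) := by
      have e : Function.update x i (x i + ((n + 1 : ℕ) : ℤ)) =
          Function.update (Function.update x i (x i + n)) i (Function.update x i (x i + n) i + 1) := by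
        rw [Function.update_self, Function.update_idem]
        push_cast
        rw [add_assoc]
      rw [e]
      exact adj_update_add_one _ _
    exact ih.trans (linked_of_stepIn ⟨hu, hv, hadj⟩)

/-- Moving one coordinate to any value within the bounds is a common-wall chain inside the box. [folklore] -/
theorem linked_pbox_update {lo hi x : Pt d} (hx : x ∈ pbox lo hi) (i : Fin d) {t : ℤ} (h1 : lo i ≤ t) (h2 : t ≤ hi i) :
    Linked (pbox lo hi) x (Function.update x i t) := by
  rcases le_or_gt (x i) t with hle | hlt
  · obtain ⟨n, hn⟩ := Int.le.dest hle
    have h := linked_pbox_update_add hx i n (by rw [hn]; exact h2)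
    rwa [hn] at h
  · -- go up from `y := update x i t` to `x`, then reverse the chain
    set y := Function.update x i t with hy_def
    have hy : y ∈ pbox lo hi := mem_pbox_update hx i h1 h2
    obtain ⟨n, hn⟩ := Int.le.dest hlt.le
    have hyi : y i = t := by rw [hy_def, Function.update_self]
    have hhi : y i + (n : ℤ) ≤ hi i := by rw [hyi, hn]; exact ((mem_pbox.1 hx) i).2
    have h := linked_pbox_update_add hy i n hhi
    have e : Function.update y i (y i + n) = x := by
      rw [hyi, hn, hy_def, Function.update_idem, Function.update_eq_self]
    rw [e] at h
    exact h.symm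

/-- **EVERY BOX OF ℤᵈ IS FACE-CONNECTED** (common-wall chains, coordinate by coordinate). [folklore] -/
theorem faceConnected_pbox (lo hi : Pt d) : FaceConnected (pbox lo hi) := by
  intro x hx y hy
  have key : ∀ j : ℕ, Linked (pbox lo hi) x (pref x y j) := by
    intro j
    induction j with
    | zero =>
      rw [pref_zero]
      exact Relation.ReflTransGen.refl
    | succ j ih =>
      by_cases hj : j < d
      · rw [pref_succ x y hj]
        have hyj := (mem_pbox.1 hy) ⟨j, hj⟩
        exact ih.trans (linked_pbox_update (pref_mem_pbox hx hy j) ⟨j, hj⟩ hyj.1 hyj.2)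
      · rw [pref_eq_of_le (show d ≤ j + 1 by omega)]
        rw [pref_eq_of_le (show d ≤ j by omega)] at ih
        exact ih
  have h := key d
  rwa [pref_eq_of_le le_rfl] at h

/-! ## §2. The MR_k-cubes as families of M-cubes: `fineCubes` (nested partitions of ratio `R`) -/

/-- The two typed floor-division indices of the cell agree: `…B13ScaleTransfer.coarse = …B14DomainGeom.cubeIdx`. [folklore] -/
theorem coarse_eq_cubeIdx (R : ℕ) (x : Pt d) : coarse R x = cubeIdx R x := rfl

/-- The corner M-cube `R·b` of the MR_k-cube of index `b`. [folklore] -/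
def corner (R : ℕ) (b : Pt d) : Pt d := fun i => (R : ℤ) * b i

/-- The corner lies in its MR_k-cube: `coarse R (R·b) = b`. [folklore] -/
theorem coarse_corner {R : ℕ} (hR : 0 < R) (b : Pt d) : coarse R (corner R b) = b :=
  cubeIdx_corner R hR b

/-- An M-cube belongs to the union of the MR_k-cubes indexed by `S` iff its MR_k-cube index lies in `S`
(`…B13Factor210Literal.mem_fineCubes`, in the `coarse` spelling). [folklore] -/
theorem mem_fineCubes_coarse {R : ℕ} (hR : 0 < R) {S : Finset (Pt d)} {x : Pt d} :
    x ∈ fineCubes R S ↔ coarse R x ∈ S :=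
  mem_fineCubes hR

/-- The M-cubes of ONE MR_k-cube, coordinatewise: `R·b_i ≤ x_i < R·b_i + R`. [folklore] -/
theorem mem_fineCubes_singleton {R : ℕ} (hR : 0 < R) {b x : Pt d} :
    x ∈ fineCubes R {b} ↔ ∀ i, (R : ℤ) * b i ≤ x i ∧ x i < (R : ℤ) * b i + R := by
  rw [mem_fineCubes_coarse hR, Finset.mem_singleton, coarse_eq_iff hR]
  simp only [mul_add, mul_one]

/-- One MR_k-cube is the product box `[R·b, R·b + R − 1]` of M-cube indices. [folklore] -/
theorem fineCubes_singleton_eq_pbox {R : ℕ} (hR : 0 < R) (b : Pt d) :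
    fineCubes R {b} = pbox (corner R b) (fun i => (R : ℤ) * b i + R - 1) := by
  ext x
  rw [mem_fineCubes_singleton hR, mem_pbox]
  refine forall_congr' fun i => ?_
  show (R : ℤ) * b i ≤ x i ∧ x i < (R : ℤ) * b i + R ↔ (R : ℤ) * b i ≤ x i ∧ x i ≤ (R : ℤ) * b i + R - 1
  rw [Int.le_sub_one_iff]

/-- The corner belongs to its MR_k-cube. [folklore] -/
theorem corner_mem_fineCubes_singleton {R : ℕ} (hR : 0 < R) (b : Pt d) : corner R b ∈ fineCubes R {b} := by
  rw [mem_fineCubes_coarse hR, coarse_corner hR, Finset.mem_singleton]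

/-- Every M-cube lies in the MR_k-cube of its index. [folklore] -/
theorem mem_fineCubes_singleton_coarse {R : ℕ} (hR : 0 < R) (x : Pt d) : x ∈ fineCubes R {coarse R x} := by
  rw [mem_fineCubes_coarse hR, Finset.mem_singleton]

/-- **ONE MR_k-CUBE CONSISTS OF `R^d` M-CUBES** (print: R_k^d; the `n` of `…B16Count196Packing`). [folklore] -/
theorem card_fineCubes_singleton {R : ℕ} (hR : 0 < R) (b : Pt d) : (fineCubes R {b}).card = R ^ d := by
  rw [fineCubes_singleton_eq_pbox hR b]
  exact card_pbox_eq_pow fun i => rfl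

/-- A union of MR_k-cubes is the union of its single MR_k-cubes. [folklore] -/
theorem fineCubes_eq_biUnion (R : ℕ) (S : Finset (Pt d)) : fineCubes R S = S.biUnion fun b => fineCubes R {b} := by
  unfold fineCubes
  simp only [Finset.singleton_biUnion]

/-- Distinct MR_k-cubes have disjoint M-cube families. [folklore] -/
theorem pairwiseDisjoint_fineCubes_singleton {R : ℕ} (hR : 0 < R) (S : Finset (Pt d)) :
    (S : Set (Pt d)).PairwiseDisjoint fun b => fineCubes R {b} :=
  fun _ _ _ _ hne => disjoint_fineCubes hR (Finset.disjoint_singleton.2 hne)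

/-- **THE CUBE COUNT ACROSS THE TWO LATTICES**: a union of `#S` MR_k-cubes consists of `R^d·#S` M-cubes (print, p. 384:
volumes `|Z|` versus cube counts `(MR_n)^{−d}|Z|`, `M^{−d}|X|`). [folklore] -/
theorem card_fineCubes {R : ℕ} (hR : 0 < R) (S : Finset (Pt d)) : (fineCubes R S).card = R ^ d * S.card := by
  rw [fineCubes_eq_biUnion, Finset.card_biUnion (pairwiseDisjoint_fineCubes_singleton hR S)]
  simp only [card_fineCubes_singleton hR, Finset.sum_const, smul_eq_mul]
  rw [mul_comm]

/-- **THE COVER OF A UNION OF MR_k-CUBES BY MR_k-CUBES IS ITSELF**: `closureIdx R (fineCubes R S) = S`. [folklore] -/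
theorem closureIdx_fineCubes {R : ℕ} (hR : 0 < R) (S : Finset (Pt d)) : closureIdx R (fineCubes R S) = S := by
  ext b
  simp only [closureIdx, Finset.mem_image]
  constructor
  · rintro ⟨x, hx, rfl⟩
    exact (mem_fineCubes_coarse hR).1 hx
  · intro hb
    exact ⟨corner R b, (mem_fineCubes_coarse hR).2 (by rw [coarse_corner hR]; exact hb), coarse_corner hR b⟩

/-- Every family of M-cubes lies in the union of the MR_k-cubes of its cover. [folklore] -/
theorem subset_fineCubes_closureIdx {R : ℕ} (hR : 0 < R) (X : Finset (Pt d)) : X ⊆ fineCubes R (closureIdx R X) :=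
  fun _ hx => (mem_fineCubes_coarse hR).2 (Finset.mem_image_of_mem _ hx)

/-- Monotonicity in the index set. [folklore] -/
theorem fineCubes_mono (R : ℕ) {S T : Finset (Pt d)} (h : S ⊆ T) : fineCubes R S ⊆ fineCubes R T :=
  Finset.biUnion_subset_biUnion_of_subset_left _ h

/-- A union of MR_k-cubes is non-empty iff its index set is. [folklore] -/
theorem fineCubes_nonempty_iff {R : ℕ} (hR : 0 < R) {S : Finset (Pt d)} : (fineCubes R S).Nonempty ↔ S.Nonempty := by
  constructor
  · rintro ⟨x, hx⟩
    exact ⟨coarse R x, (mem_fineCubes_coarse hR).1 hx⟩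
  · rintro ⟨b, hb⟩
    exact ⟨corner R b, fineCubes_mono R (Finset.singleton_subset_iff.2 hb) (corner_mem_fineCubes_singleton hR b)⟩

/-- Ratio 1: the partition does not change. [folklore] -/
theorem fineCubes_one (S : Finset (Pt d)) : fineCubes 1 S = S := by
  ext x
  rw [mem_fineCubes_coarse Nat.one_pos, B16SProfile.coarse_one]

/-- «X is a union of MR_k-cubes» (X equals the union of the MR_k-cubes of its cover) gives the two-lattice count
`#X = R^d · #(cover)`. [folklore] -/
theorem card_eq_of_cubeUnion {R : ℕ} (hR : 0 < R) {X : Finset (Pt d)} (h : fineCubes R (closureIdx R X) = X) :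
    X.card = R ^ d * (closureIdx R X).card := by
  conv_lhs => rw [← h]
  exact card_fineCubes hR _

/-! ## §3. The two volume clauses from the MR_k-lattice -/

/-- **A NON-EMPTY UNION OF MR_k-CUBES HOLDS AT LEAST `R^d` M-CUBES** — the cube content `n = R_k^d` of one class-1 component
(cell reading S-B16.13 of (1.96): «each X_{j_h} contains an MR_k-cube, hence ≥ R_k^d M-cubes»). [cite: Balaban1989LargeFieldII, (1.96) p.389] -/
theorem pow_le_card_fineCubes {R : ℕ} (hR : 0 < R) {S : Finset (Pt d)} (hS : S.Nonempty) : R ^ d ≤ (fineCubes R S).card := by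
  rw [card_fineCubes hR]
  exact Nat.le_mul_of_pos_right _ (Finset.card_pos.2 hS)

/-- **A UNION OF MR_k-CUBES SATISFYING (i) WITH SIZE `Nsz` HOLDS AT MOST `(Nsz·R)^d` M-CUBES** — the volume bound
`M^{−d}|X_{j_h}| ≤ (100R_k)^d` behind *"estimated by ∏_{h=1}^q exp 2κ(100R_k)^d"*. [cite: Balaban1989LargeFieldII, p.389 (product over h)] -/
theorem card_fineCubes_le_of_condI {R : ℕ} (hR : 0 < R) {Nsz : ℕ} {S : Finset (Pt d)} (h : CondI Nsz S) :
    (fineCubes R S).card ≤ (Nsz * R) ^ d := by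
  rw [card_fineCubes hR, mul_pow, mul_comm]
  exact Nat.mul_le_mul_right _ (card_le_pow_of_condI h)

/-- **CONDITION (i) ACROSS THE TWO LATTICES**: if the MR_k-cover of `X` fits in a box of `Nsz` MR_k-cubes per side, then `X`
fits in a box of `Nsz·R` M-cubes per side. [cite: Balaban1989LargeFieldI, p.177 (condition (i))] -/
theorem fitsIn_of_fitsIn_closureIdx {R : ℕ} (hR : 0 < R) {Nsz : ℕ} {X : Finset (Pt d)}
    (h : B14BoxFix.FitsIn Nsz (↑(closureIdx R X) : Set (Pt d))) : B14BoxFix.FitsIn (Nsz * R) (↑X : Set (Pt d)) := by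
  obtain ⟨lo, hlo⟩ := h
  refine ⟨corner R lo, fun x hx i => ?_⟩
  have hb := hlo (Finset.mem_coe.2 (Finset.mem_image_of_mem (coarse R) (Finset.mem_coe.1 hx))) i
  have hx1 := (coarse_eq_iff hR x (coarse R x)).1 rfl i
  have hR0 : (0 : ℤ) ≤ (R : ℤ) := by positivity
  obtain ⟨hb1, hb2⟩ := hb
  obtain ⟨hx1a, hx1b⟩ := hx1
  have h3 : (R : ℤ) * lo i ≤ (R : ℤ) * coarse R x i := mul_le_mul_of_nonneg_left hb1 hR0
  have h4 : (R : ℤ) * (coarse R x i + 1) ≤ (R : ℤ) * (lo i + (Nsz : ℤ)) := mul_le_mul_of_nonneg_left (by linarith) hR0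
  show corner R lo i ≤ x i ∧ x i ≤ corner R lo i + ((Nsz * R : ℕ) : ℤ) - 1
  simp only [corner]
  push_cast
  constructor
  · linarith
  · have h5 : x i + 1 ≤ (R : ℤ) * lo i + (Nsz : ℤ) * R := by nlinarith
    linarith

/-- The same for a union of MR_k-cubes given by its index set: `FitsIn Nsz S → FitsIn (Nsz·R) (fineCubes R S)`.
[cite: Balaban1989LargeFieldI, p.177 (condition (i))] -/
theorem fitsIn_fineCubes {R : ℕ} (hR : 0 < R) {Nsz : ℕ} {S : Finset (Pt d)} (h : B14BoxFix.FitsIn Nsz (↑S : Set (Pt d))) :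
    B14BoxFix.FitsIn (Nsz * R) (↑(fineCubes R S) : Set (Pt d)) :=
  fitsIn_of_fitsIn_closureIdx hR (by rw [closureIdx_fineCubes hR]; exact h)

/-! ## §4. Face-connectedness across the two lattices -/

/-- One MR_k-cube is a face-connected family of M-cubes. [folklore] -/
theorem faceConnected_fineCubes_singleton {R : ℕ} (hR : 0 < R) (b : Pt d) : FaceConnected (fineCubes R {b}) := by
  rw [fineCubes_singleton_eq_pbox hR b]
  exact faceConnected_pbox _ _

/-- The corner of the MR_k-cube `b + e_i` is one unit step (in direction `i`) beyond the far face of the MR_k-cube `b`.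
[folklore] -/
theorem corner_update_eq {R : ℕ} (b : Pt d) (i : Fin d) :
    corner R (Function.update b i (b i + 1)) =
      Function.update (Function.update (corner R b) i ((R : ℤ) * b i + R - 1)) i
        (Function.update (corner R b) i ((R : ℤ) * b i + R - 1) i + 1) := by
  rw [Function.update_self, Function.update_idem]
  funext j
  by_cases hji : j = i
  · subst hji
    rw [Function.update_self]
    simp only [corner, Function.update_self]
    ring
  · rw [Function.update_of_ne hji]
    simp only [corner, Function.update_of_ne hji]

/-- The corners of the MR_k-cubes `b` and `b + e_i`, both in `S`, are chain-connected inside the M-cubes of `S`: across the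
cube `b` to its far face, then one common-wall step. [folklore] -/
theorem linked_corner_update {R : ℕ} (hR : 0 < R) {S : Finset (Pt d)} {b : Pt d} {i : Fin d} (hb : b ∈ S)
    (hb' : Function.update b i (b i + 1) ∈ S) :
    Linked (fineCubes R S) (corner R b) (corner R (Function.update b i (b i + 1))) := by
  have hR1 : (1 : ℤ) ≤ (R : ℤ) := by exact_mod_cast hR
  set p : Pt d := Function.update (corner R b) i ((R : ℤ) * b i + R - 1) with hp_def
  have hsub : fineCubes R {b} ⊆ fineCubes R S := fineCubes_mono R (Finset.singleton_subset_iff.2 hb)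
  have hcorner : corner R b ∈ fineCubes R {b} := corner_mem_fineCubes_singleton hR b
  have hp : p ∈ fineCubes R {b} := by
    rw [fineCubes_singleton_eq_pbox hR] at hcorner ⊢
    exact mem_pbox_update hcorner i (by simp only [corner]; linarith) le_rfl
  have h1 : Linked (fineCubes R S) (corner R b) p :=
    ((faceConnected_fineCubes_singleton hR b) _ hcorner _ hp).mono hsub
  have hadj : Adj p (corner R (Function.update b i (b i + 1))) := by
    rw [corner_update_eq b i]
    exact adj_update_add_one _ _
  have hc' : corner R (Function.update b i (b i + 1)) ∈ fineCubes R S :=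
    fineCubes_mono R (Finset.singleton_subset_iff.2 hb') (corner_mem_fineCubes_singleton hR _)
  exact h1.trans (linked_of_stepIn ⟨hsub hp, hc', hadj⟩)

/-- The corners of two MR_k-cubes of `S` with a common wall are chain-connected inside the M-cubes of `S`. [folklore] -/
theorem linked_corner_of_adj {R : ℕ} (hR : 0 < R) {S : Finset (Pt d)} {b b' : Pt d} (hb : b ∈ S) (hb' : b' ∈ S)
    (h : Adj b b') : Linked (fineCubes R S) (corner R b) (corner R b') := by
  obtain ⟨i, h | h⟩ := h
  · subst h
    exact linked_corner_update hR hb hb'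
  · subst h
    exact (linked_corner_update hR hb' hb).symm

/-- Inside the M-cubes of a face-connected family `S` of MR_k-cubes, every M-cube is chain-connected to the corner of every
MR_k-cube of `S`. [folklore] -/
theorem linked_fineCubes_corner {R : ℕ} (hR : 0 < R) {S : Finset (Pt d)} (hS : FaceConnected S) {x : Pt d}
    (hx : x ∈ fineCubes R S) {b : Pt d} (hb : b ∈ S) : Linked (fineCubes R S) x (corner R b) := by
  have hbx : coarse R x ∈ S := (mem_fineCubes_coarse hR).1 hx
  have hsub : fineCubes R {coarse R x} ⊆ fineCubes R S := fineCubes_mono R (Finset.singleton_subset_iff.2 hbx)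
  have h0 : Linked (fineCubes R S) x (corner R (coarse R x)) :=
    ((faceConnected_fineCubes_singleton hR (coarse R x)) _ (mem_fineCubes_singleton_coarse hR x) _
      (corner_mem_fineCubes_singleton hR _)).mono hsub
  have key : ∀ {c : Pt d}, Linked S (coarse R x) c → Linked (fineCubes R S) x (corner R c) := by
    intro c hc
    unfold Linked at hc
    induction hc with
    | refl => exact h0
    | tail _ hstep ih => exact ih.trans (linked_corner_of_adj hR hstep.1 hstep.2.1 hstep.2.2)
  exact key (hS _ hbx _ hb)

/-- **THE M-CUBE FAMILY OF A FACE-CONNECTED FAMILY OF MR_k-CUBES IS FACE-CONNECTED** (a connected union of MR_k-cubes is a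
connected union of M-cubes: the `FaceConnected (comp j)` of `Model.comp_spec` from the MR_k-lattice). [folklore] -/
theorem faceConnected_fineCubes {R : ℕ} (hR : 0 < R) {S : Finset (Pt d)} (hS : FaceConnected S) :
    FaceConnected (fineCubes R S) := by
  intro x hx y hy
  have hby : coarse R y ∈ S := (mem_fineCubes_coarse hR).1 hy
  exact (linked_fineCubes_corner hR hS hx hby).trans (linked_fineCubes_corner hR hS hy hby).symm

/-- … and conversely (`…B13ScaleTransfer.faceConnected_closureIdx` with `closureIdx_fineCubes`): connectedness is the same
on both lattices. [folklore] -/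
theorem faceConnected_fineCubes_iff {R : ℕ} (hR : 0 < R) {S : Finset (Pt d)} :
    FaceConnected (fineCubes R S) ↔ FaceConnected S :=
  ⟨fun h => by simpa only [closureIdx_fineCubes hR] using faceConnected_closureIdx hR h, faceConnected_fineCubes hR⟩

/-! ## §5. The class-1 hypothesis and the two `Model` clauses at the printed grades -/

/-- **THE CLASS-1 HYPOTHESIS** on the components `comp j`, `j ∈ cand`, of a lattice model (M-cube families), with the ratio
`R` (= R_k) and the size `Nsz` (print: 100) of condition (i): `R ≥ 1`; every `comp j` IS the union of the MR_k-cubes of its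
cover («X_j is a union of MR_k-cubes», pp. 378/384); the cover satisfies (i) on the MR_k-lattice («contained in a cube of
the size 100MR_k», p. 387 with [I] p. 177).  Binders for the joiner, not assertions. [cite: Balaban1989LargeFieldII, pp.384-389] -/
structure ClassOne (R Nsz : ℕ) {LF : Type*} (cand : Finset LF) (comp : LF → Finset (Pt d)) : Prop where
  R_pos : 0 < R
  cubeUnion : ∀ j ∈ cand, fineCubes R (closureIdx R (comp j)) = comp j
  condI : ∀ j ∈ cand, CondI Nsz (closureIdx R (comp j))

namespace ClassOne

variable {R Nsz : ℕ} {LF : Type*} {cand : Finset LF} {comp : LF → Finset (Pt d)}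

/-- The class-1 hypothesis from components GIVEN on the MR_k-lattice: `comp j = fineCubes R (S j)` with `CondI Nsz (S j)`.
[folklore] -/
theorem of_fineCubes (hR : 0 < R) (S : LF → Finset (Pt d)) (hcomp : ∀ j ∈ cand, comp j = fineCubes R (S j))
    (hI : ∀ j ∈ cand, CondI Nsz (S j)) : ClassOne R Nsz cand comp where
  R_pos := hR
  cubeUnion := fun j hj => by rw [hcomp j hj, closureIdx_fineCubes hR]
  condI := fun j hj => by rw [hcomp j hj, closureIdx_fineCubes hR]; exact hI j hj

/-- `M^{−d}|X_j| = R^d · (number of MR_k-cubes of X_j)`. [folklore] -/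
theorem card_eq (h : ClassOne R Nsz cand comp) {j : LF} (hj : j ∈ cand) :
    (comp j).card = R ^ d * (closureIdx R (comp j)).card :=
  card_eq_of_cubeUnion h.R_pos (h.cubeUnion j hj)

/-- **THE VOLUME CLAUSE `Model.card_le` AT `V = (Nsz·R)^d`** (print: (100R_k)^d). [cite: Balaban1989LargeFieldII, p.389 (product over h)] -/
theorem card_le (h : ClassOne R Nsz cand comp) : ∀ j ∈ cand, ((comp j).card : ℝ) ≤ ((Nsz : ℝ) * R) ^ d := by
  intro j hj
  have h1 : (comp j).card ≤ (Nsz * R) ^ d := by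
    rw [← h.cubeUnion j hj]
    exact card_fineCubes_le_of_condI h.R_pos (h.condI j hj)
  exact_mod_cast h1

/-- **THE CUBE-CONTENT CLAUSE `Model.le_card` AT `n = R^d`** (print: each X_j holds ≥ R_k^d M-cubes), for non-empty
components. [cite: Balaban1989LargeFieldII, (1.96) p.389] -/
theorem le_card (h : ClassOne R Nsz cand comp) (hne : ∀ j ∈ cand, (comp j).Nonempty) :
    ∀ j ∈ cand, R ^ d ≤ (comp j).card := by
  intro j hj
  rw [← h.cubeUnion j hj]
  exact pow_le_card_fineCubes h.R_pos (closureIdx_nonempty (hne j hj))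

end ClassOne

variable {W : Window d} {LF : Type*} {P : B16Ineq197.Polymer LF W.relSys.Dom} {X' L : Finset (Pt d)} {V : ℝ} {n : ℕ}

/-- **RE-GRADING A MODEL**: a lattice model at grades `(V, n)` whose components have between `n'` and `V'` cubes is a
lattice model at grades `(V', n')` — all other fields are grade-free. [folklore] -/
def regrade (M : Model W P X' L V n) {V' : ℝ} {n' : ℕ} (hV : ∀ j ∈ P.cand, ((M.comp j).card : ℝ) ≤ V')
    (hn : ∀ j ∈ P.cand, n' ≤ (M.comp j).card) : Model W P X' L V' n' :=
  { M with card_le := hV, le_card := hn }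

/-- Re-grading keeps the components. [folklore] -/
theorem regrade_comp (M : Model W P X' L V n) {V' : ℝ} {n' : ℕ} (hV : ∀ j ∈ P.cand, ((M.comp j).card : ℝ) ≤ V')
    (hn : ∀ j ∈ P.cand, n' ≤ (M.comp j).card) : (regrade M hV hn).comp = M.comp := rfl

/-- The trivial grades: ANY pre-model data gives a `Model` at `V = #X′`, `n = 0` (every component lies in X′), so a joiner may
build the model first and grade it afterwards. [folklore] -/
theorem card_le_card_of_subset_sdiff {cand : Finset LF} {comp : LF → Finset (Pt d)} (h : ∀ j ∈ cand, comp j ⊆ X' \ L) :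
    ∀ j ∈ cand, ((comp j).card : ℝ) ≤ (X'.card : ℝ) := fun j hj => by
  exact_mod_cast Finset.card_le_card ((h j hj).trans Finset.sdiff_subset)

/-- **THE MODEL AT THE PRINTED GRADES FROM THE CLASS-1 HYPOTHESIS**: a lattice model at any grades whose components satisfy
`ClassOne R Nsz` is a lattice model at `V = (Nsz·R)^d`, `n = R^d` (non-emptiness of the components is `Model.comp_spec`).
[cite: Balaban1989LargeFieldII, pp.388-389] -/
def classOne (M : Model W P X' L V n) {R Nsz : ℕ} (h : ClassOne R Nsz P.cand M.comp) :
    Model W P X' L (((Nsz : ℝ) * R) ^ d) (R ^ d) :=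
  regrade M h.card_le (h.le_card fun j hj => (M.comp_spec j hj).2.1)

/-- The class-one model keeps the components. [folklore] -/
theorem classOne_comp (M : Model W P X' L V n) {R Nsz : ℕ} (h : ClassOne R Nsz P.cand M.comp) :
    (classOne M h).comp = M.comp := rfl

/-- **ALL FIVE LATTICE LEAVES with the volume clauses discharged**: a model at any grades, the class-1 hypothesis, the clauses
at the grades `V = (Nsz·R)^d`, `n = R^d`, `Consts.Small` and the size reading give the five leaves
(`…B16Ineq197Window.Model.leaves`). [cite: Balaban1989LargeFieldII, (1.93)-(1.96) pp.388-389] -/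
theorem leaves_classOne (M : Model W P X' L V n) {R Nsz : ℕ} (h : ClassOne R Nsz P.cand M.comp) (K : B16Ineq197.Consts)
    (hK : K.Small) (hC : Clauses K d (((Nsz : ℝ) * R) ^ d) (R ^ d)) (hdX : P.dX ≤ relTreeLen X' (X' \ L)) :
    P.Subadd193 K ∧ P.Vol193 K ∧ P.XBudget K ∧ P.Anch194 K ∧ P.Count196 K :=
  (classOne M h).leaves K hK hC hdX

/-- **(1.92)–(1.96) ⇒ (1.97) ON THE LATTICE CARRIER WITH THE VOLUME CLAUSES DISCHARGED**: `…B16Ineq197Window.ineq197_window`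
in which every polymer's model is given at arbitrary grades together with the class-1 hypothesis `ClassOne R Nsz`, and the
clauses are required at `V = (Nsz·R)^d`, `n = R^d`. [cite: Balaban1989LargeFieldII, (1.92)-(1.97) pp.388-390] -/
theorem ineq197_classOne (WL W : Window d) {LF Φ : Type*} (dom : WL.relSys.Dom → Set Φ)
    (P : WL.relSys.Dom → B16Ineq197.Polymer LF W.relSys.Dom) (K : B16Ineq197.Consts) (hK : K.Small) {R Nsz : ℕ}
    (hC : Clauses K d (((Nsz : ℝ) * R) ^ d) (R ^ d)) (Vg : WL.relSys.Dom → ℝ) (ng : WL.relSys.Dom → ℕ)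
    (M : ∀ X, Model W (P X) X.1 WL.Z (Vg X) (ng X)) (hM : ∀ X, ClassOne R Nsz (P X).cand (M X).comp)
    (hdX : ∀ X, (P X).dX = WL.relSys.dRel X)
    (term : WL.relSys.Dom → Finset LF × Finset W.relSys.Dom → Φ → ℂ) (F : WL.relSys.Dom → Φ → ℂ)
    (hF : ∀ X, ∀ φ ∈ dom X, F X φ = ∑ p ∈ (P X).adm, term X p φ)
    (h192 : ∀ X, ∀ φ ∈ dom X, (P X).Major192 K (fun p => term X p φ))
    (selA : ∀ X, WL.relSys.MeetsLF X → ∀ p ∈ (P X).adm, p.2.Nonempty)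
    (selB : ∀ X, ¬ WL.relSys.MeetsLF X → ∀ p ∈ (P X).adm, p.1.Nonempty) :
    B16.Ineq197 WL.relSys dom F K.p0 K.α K.β K.κ :=
  B16Ineq197Window.ineq197_window WL W dom P K hK hC (fun X => classOne (M X) (hM X)) hdX term F hF h192 selA selB

/-- **THE PRINTED GRADES AT d = 4, Nsz = 100**: the clauses of `…B16Ineq197Window.clauses_four_printed` (V = (100R)^4,
n = R^4, ρ = 100^4·R^{−4}) ARE the clauses required by `classOne` ∕ `ineq197_classOne` with Nsz = 100.
[cite: Balaban1989LargeFieldII, (1.93)-(1.96) pp.388-389] -/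
theorem clauses_printed_four (K : B16Ineq197.Consts) (hK : K.Small) (R : ℕ) (hR : 0 < R) (hcJ : 2 ≤ K.cJ)
    (ha₁ : 64 ≤ K.a₁) (ha₀ : 64 ≤ K.a₀) (hκ : 4215 ≤ K.β * K.κ / 2) (hC₁ : B14.RelAnimal.Krel (4 * 2 ^ 4) (3 ^ 4 - 1) ≤ K.C₁)
    (hβlam : K.β * (1 + K.lam) ≤ 1 / 2) (hE : 2 * K.κ * ((100 : ℝ) * R) ^ 4 ≤ K.E)
    (hρ : K.ρ = (100 : ℝ) ^ 4 * ((R : ℝ) ^ 4)⁻¹) : Clauses K 4 ((((100 : ℕ) : ℝ) * R) ^ 4) (R ^ 4) := by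
  rw [Nat.cast_ofNat]
  exact B16Ineq197Window.clauses_four_printed K hK R hR hcJ ha₁ ha₀ hκ hC₁ hβlam hE hρ

/-! ## §6. Non-vacuity: the toy model of `…B16Ineq197Window` is class-one (R = 1, Nsz = 2) at its own grades -/

namespace Toy

open Literature.MathematicalPhysics.QuantumFieldTheory.Balaban1983to89.B16Ineq197Window.Toy (toyW toyP toyM B₂ toyW_Z toyK
  toy_clauses toy_small)

/-- The two toy cubes 0, 1 of ℤ¹ lie in the box [0, 1]. [folklore] -/
theorem B₂_subset_pbox : B₂ ⊆ pbox (fun _ : Fin 1 => (0 : ℤ)) (fun _ => 1) := by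
  intro x hx
  rw [mem_pbox]
  intro i
  simp only [B₂, Finset.mem_insert, Finset.mem_singleton] at hx
  rcases hx with rfl | rfl <;> simp [B16Ineq197RelGlue.Toy.tpt]

/-- Every domain of the toy window satisfies (i) with size 2 (R = 1: the MR_k-lattice is the M-lattice). [folklore] -/
theorem condI_two (X : toyW.relSys.Dom) : CondI 2 X.1 :=
  B16MergeHorizon.fitsIn_of_subset_pbox (X.2.1.trans B₂_subset_pbox) fun _ => by norm_num

/-- **The toy model is class-one** with ratio R = 1 and size Nsz = 2. [folklore] -/
theorem classOne_toy (X : toyW.relSys.Dom) : ClassOne 1 2 (toyP X).cand (toyM X).comp :=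
  ClassOne.of_fineCubes Nat.one_pos (fun _ => X.1) (fun _ _ => (fineCubes_one X.1).symm) fun _ _ => condI_two X

/-- … and `classOne` returns it at the grades V = (2·1)^1 = 2, n = 1^1 = 1 of `…Window.Toy.toy_clauses`, with the same
components. [folklore] -/
theorem toyM_classOne_grades (X : toyW.relSys.Dom) :
    (((2 : ℕ) : ℝ) * (1 : ℕ)) ^ 1 = 2 ∧ (1 : ℕ) ^ 1 = 1 ∧ (classOne (toyM X) (classOne_toy X)).comp = (toyM X).comp :=
  ⟨by norm_num, rfl, rfl⟩

/-- The five leaves for the toy polymer through `leaves_classOne` (clauses transported to the class-one grades). [folklore] -/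
theorem toy_leaves_classOne (X : toyW.relSys.Dom) :
    (toyP X).Subadd193 toyK ∧ (toyP X).Vol193 toyK ∧
      (toyP X).XBudget toyK ∧ (toyP X).Anch194 toyK ∧
      (toyP X).Count196 toyK := by
  have hC : Clauses toyK 1 ((((2 : ℕ) : ℝ) * (1 : ℕ)) ^ 1) ((1 : ℕ) ^ 1) := by
    rw [(toyM_classOne_grades X).1]
    exact toy_clauses
  exact leaves_classOne (toyM X) (classOne_toy X) _ toy_small hC
    (le_of_eq rfl)

end Toy

end

end Literature.MathematicalPhysics.QuantumFieldTheory.Balaban1983to89.B16Ineq197ClassOne
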